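import Mathlib
import HarnessLib
import Literature.Analysis.FluidPDE.VectorCalculus
import Literature.Analysis.FluidPDE.VorticityCalculus
import Literature.Analysis.FluidPDE.HarmonicProbe
import Literature.Analysis.FluidPDE.CurlFreeLiouville
import Literature.Analysis.FluidPDE.EssCurry
import Literature.Analysis.FluidPDE.AxisymmetricVorticityTransport
import Literature.Analysis.PDE.HeatLiouville
import Summits.NavierStokesRegularity.NavierStokesRegularity.Theorems.UnthreadedDoorVorticityOfClass
import Summits.NavierStokesRegularity.NavierStokesRegularity.Theorems.UnthreadedDoorConstantOfIrrotational
import Summits.NavierStokesRegularity.NavierStokesRegularity.Theorems.UnthreadedDoorAntidynamoSingleDegreeVorticity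
import Summits.NavierStokesRegularity.NavierStokesRegularity.Theorems.UnthreadedDoorAntidynamoSingleDegreeRungGradientBranch

/-!
# Route `UnthreadedDoor` / `ThreadingFlux`, crux `PoloidalLiouville` (stmt-NavierStokesRegularity-1222), antidynamo v2 skeleton
# (sha16 `4ebf5683127b`), rung `stub_singleDegreeRung` (BC5): ★★★ THE RUNG FOR ODD DEGREE `l` — PARITY MAKES THE VORTICITY CALORIC

Support file (seat leafhand-ns-unthreadeddoor-1 g1, cell decomp-ns), `--supports stmt-NavierStokesRegularity-1222 --as helper`; theorems only.

THE ARGUMENT (replaces the (E1)-tower route S5-odd of the g0 census by a three-line parity argument; no regularity of the radial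
coefficient at the centre, no lift to `ℝ^{2l+3}`, no decay is needed).  Let `σ` be the point reflection about the centre `x₀`.
1. KINEMATICS (`reflect_eq_of_curl_odd`).  By step S2 (`singleDegree_vorticity_structure`, g0) every slice has vorticity
   `curl v = ĝ(‖y‖) • Λ(y)`, `Λ = ∇P × y`, and for ODD `l` the solid harmonic `P` is odd, `∇P` even, `Λ` odd: the vorticity is ODD under
   `σ`.  Then `v − v ∘ σ` is curl-free, divergence-free and bounded on `ℝ³`, hence constant (tree `eq_of_curl_eq_zero_of_isDivFree_of_bounded`),
   and the constant is minus itself: EVERY SLICE IS EVEN about `x₀`.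
2. DYNAMICS (`timeDerivWithin_vorticity_eq_laplacian_of_even`).  In the vorticity equation `∂ₜω + (v·∇)ω = (ω·∇)v + Δω` (the class solves
   it classically, bridge stub `stub_vorticityOfClass`) with `v` even and `ω` odd, transport and stretching are even while `∂ₜω`, `Δω` are
   odd; comparing the equation at `x` and `σ x` gives `∂ₜω = Δω` POINTWISE: the vorticity is a bounded ancient CALORIC field on `(−∞,0) × ℝ³`.
3. LIOUVILLE (`curl_eq_zero_of_odd_caloric`).  By the tree's Liouville theorem for bounded ancient solutions of the heat equation
   (`Literature.Analysis.PDE.heat_liouville`, exponent `γ = 0`) the vorticity is constant on the slab, and an odd constant is `0`; the landed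
   stub `stub_constantOfIrrotational` makes every slice constant.
MAIN: `singleDegreeRung_odd` — the registered rung `StubSingleDegreeRung` with the extra conjunct `Odd l` (degrees `l = 3, 5, 7, …`: the
first NON-AXISYMMETRIC sub-cases of the crux; `P = 0` is the landed gradient branch).

WHAT THIS IS NOT.  Even `l` is NOT covered: there parity only yields `(c·∇)ω = 0`, `v − v(x₀)` odd, and the full nonlinear term survives
(it contains the axisymmetric `l = 2` content of KNSS 2009 Thm 5.2).  Nothing here proves the registered rung for all `l`, the wall
`stub_scalarLiouville`, `PoloidalLiouville` (1222), or bears on Navier–Stokes regularity; no summit statement is proved. [folklore]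
-/

noncomputable section

-- the summit and its single sub-problem share the name (CONVENTIONS §1)
set_option linter.dupNamespace false

open scoped Topology InnerProductSpace RealInnerProductSpace ContDiff Laplacian
open Filter Set Function Metric MeasureTheory MvPolynomial
open Literature.Analysis.FluidPDE

namespace Summit.NavierStokesRegularity.NavierStokesRegularity.Theorems.PoloidalLiouville.Antidynamo

/-! ### 0. Reflection calculus `w ↦ c − w` (the point reflection about `c/2`) -/

/-- `curl (V(c − ·))(y) = −(curl V)(c − y)` (no differentiability hypothesis: both sides are junk together). [folklore] -/
theorem curl_comp_const_sub (V : EuclideanSpace ℝ (Fin 3) → EuclideanSpace ℝ (Fin 3)) (c y : EuclideanSpace ℝ (Fin 3)) :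
    curl (fun w => V (c - w)) y = -curl V (c - y) := by
  rw [curl_eq_curlCLM, curl_eq_curlCLM, fderiv_comp_const_sub, map_neg]

/-- `div (V(c − ·))(y) = −(div V)(c − y)`. [folklore] -/
theorem divergence_comp_const_sub (V : EuclideanSpace ℝ (Fin 3) → EuclideanSpace ℝ (Fin 3)) (c y : EuclideanSpace ℝ (Fin 3)) :
    VectorCalculus.divergence (fun w => V (c - w)) y = -VectorCalculus.divergence V (c - y) := by
  simp only [VectorCalculus.divergence, fderiv_comp_const_sub, ContinuousLinearMap.toLinearMap_neg, map_neg]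

/-! ### 1. Kinematics: odd vorticity forces an even velocity -/

/-- **A bounded divergence-free `C²` field on `ℝ³` whose curl is ODD under the reflection `w ↦ c − w` is EVEN under it.**
(`V − V(c − ·)` is curl-free, divergence-free and bounded, hence constant by the tree's curl-free Liouville theorem; the constant `k`
satisfies `k = −k`.) [folklore] -/
theorem reflect_eq_of_curl_odd {V : EuclideanSpace ℝ (Fin 3) → EuclideanSpace ℝ (Fin 3)} (hV : ContDiff ℝ 2 V)
    (hdiv : VectorCalculus.IsDivFree V) {M : ℝ} (hM : ∀ x, ‖V x‖ ≤ M) (c : EuclideanSpace ℝ (Fin 3))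
    (hodd : ∀ y, curl V (c - y) = -curl V y) : ∀ y, V (c - y) = V y := by
  set W : EuclideanSpace ℝ (Fin 3) → EuclideanSpace ℝ (Fin 3) := fun y => V y - V (c - y) with hW
  have hVσ : ContDiff ℝ 2 (fun y => V (c - y)) := hV.comp (contDiff_const.sub contDiff_id)
  have hW2 : ContDiff ℝ 2 W := hV.sub hVσ
  have hcurl : ∀ y, curl W y = 0 := by
    intro y
    have h1 : DifferentiableAt ℝ V y := (hV.differentiable (by norm_num)).differentiableAt
    have h2 : DifferentiableAt ℝ (fun w => V (c - w)) y := (hVσ.differentiable (by norm_num)).differentiableAt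
    rw [hW, curl_sub h1 h2, curl_comp_const_sub, hodd y, neg_neg, sub_self]
  have hWdiv : VectorCalculus.IsDivFree W := by
    intro y
    have h1 : DifferentiableAt ℝ V y := (hV.differentiable (by norm_num)).differentiableAt
    have h2 : DifferentiableAt ℝ (fun w => V (c - w)) y := (hVσ.differentiable (by norm_num)).differentiableAt
    have : fderiv ℝ W y = fderiv ℝ V y - fderiv ℝ (fun w => V (c - w)) y := by
      rw [hW]; exact fderiv_sub h1 h2
    have hd1 : VectorCalculus.divergence V y = 0 := hdiv y
    have hd3 : VectorCalculus.divergence V (c - y) = 0 := hdiv (c - y)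
    have hd2 := divergence_comp_const_sub V c y
    simp only [VectorCalculus.divergence] at hd1 hd2 hd3 ⊢
    rw [this, ContinuousLinearMap.toLinearMap_sub, map_sub, hd2, hd1, hd3, neg_zero, sub_zero]
  have hWb : ∀ y, ‖W y‖ ≤ M + M := fun y =>
    (norm_sub_le _ _).trans (add_le_add (hM y) (hM (c - y)))
  intro y
  have hconst := eq_of_curl_eq_zero_of_isDivFree_of_bounded hW2 hcurl hWdiv hWb y (c - y)
  -- `W (c − y) = −W y`
  have hanti : W (c - y) = -W y := by
    simp only [hW, sub_sub_cancel, neg_sub]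
  have hzero : W y = 0 := by
    have h2 : W y = -W y := hconst.trans hanti
    have h3 : (2 : ℝ) • W y = 0 := by rw [two_smul]; nth_rewrite 2 [h2]; exact add_neg_cancel _
    exact (smul_eq_zero.1 h3).resolve_left two_ne_zero
  have : V y - V (c - y) = 0 := hzero
  exact (sub_eq_zero.1 this).symm

/-! ### 2. Parity of the single-degree vorticity for odd `l` -/

/-- A homogeneous polynomial of ODD degree is an odd function: `P(−y) = −P(y)`. [folklore] -/
theorem evalPoly_neg_of_odd {P : MvPolynomial (Fin 3) ℝ} {l : ℕ} (hP : P.IsHomogeneous l) (hl : Odd l)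
    (y : EuclideanSpace ℝ (Fin 3)) :
    eval (fun i => (-y) i) P = -eval (fun i => y i) P := by
  have h := evalPoly_smul hP (-1) y
  rw [neg_one_smul] at h
  rw [h, hl.neg_one_pow, neg_one_mul]

/-- … so its gradient is even: `∇P(−y) = ∇P(y)` (no differentiability bookkeeping: `D(f(0 − ·)) = −Df(0 − ·)` holds for junk
values too). [folklore] -/
theorem gradient_evalPoly_neg_of_odd {P : MvPolynomial (Fin 3) ℝ} {l : ℕ} (hP : P.IsHomogeneous l) (hl : Odd l)
    (y : EuclideanSpace ℝ (Fin 3)) :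
    gradient (fun z : EuclideanSpace ℝ (Fin 3) => eval (fun i => z i) P) (-y) =
      gradient (fun z : EuclideanSpace ℝ (Fin 3) => eval (fun i => z i) P) y := by
  set Q : EuclideanSpace ℝ (Fin 3) → ℝ := fun z => eval (fun i => z i) P with hQ
  have hfun : (fun w => Q (0 - w)) = -Q := by
    funext w
    rw [zero_sub, Pi.neg_apply]
    exact evalPoly_neg_of_odd hP hl w
  have h1 : fderiv ℝ (fun w => Q (0 - w)) y = -fderiv ℝ Q (0 - y) := fderiv_comp_const_sub Q 0 y
  rw [hfun, fderiv_neg, zero_sub] at h1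
  have h2 : fderiv ℝ Q (-y) = fderiv ℝ Q y := (neg_injective h1).symm
  rw [gradient, gradient, h2]

/-- … and the toroidal profile `Λ = ∇P × id` is odd: `Λ(−y) = −Λ(y)`. [folklore] -/
theorem crossGradient_neg_of_odd {P : MvPolynomial (Fin 3) ℝ} {l : ℕ} (hP : P.IsHomogeneous l) (hl : Odd l)
    (y : EuclideanSpace ℝ (Fin 3)) :
    cross (gradient (fun z : EuclideanSpace ℝ (Fin 3) => eval (fun i => z i) P) (-y)) (-y) =
      -cross (gradient (fun z : EuclideanSpace ℝ (Fin 3) => eval (fun i => z i) P) y) y := by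
  rw [gradient_evalPoly_neg_of_odd hP hl y, ← crossCLM_apply, map_neg, crossCLM_apply]

/-- **ODD VORTICITY.**  Under the hypotheses of the rung with a non-zero profile `P` of ODD degree `l ≥ 2`, every slice has a vorticity
that is odd under the point reflection about the centre: `curl (v t) (x₀ + x₀ − x) = −curl (v t) x` (off the centre by step S2,
`singleDegree_vorticity_structure`, and the oddness of `Λ`; at the centre by continuity). [folklore] -/
theorem curl_reflect_of_odd
    (v : ℝ → EuclideanSpace ℝ (Fin 3) → EuclideanSpace ℝ (Fin 3)) (x₀ : EuclideanSpace ℝ (Fin 3))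
    (hB : Literature.Analysis.FluidPDE.IsBoundedAncientMildSolution 1 v)
    (hm : ∀ t < 0, AEStronglyMeasurable (v t) volume)
    (hsm : ContDiffOn ℝ (⊤ : ℕ∞) (Function.uncurry v) (Set.Iio 0 ×ˢ Set.univ))
    {l : ℕ} {P : MvPolynomial (Fin 3) ℝ} (hl : 2 ≤ l) (hodd : Odd l) (hP : P.IsHomogeneous l) (hP0 : P ≠ 0)
    (hharm : ∀ y : EuclideanSpace ℝ (Fin 3),
      Laplacian.laplacian (fun z : EuclideanSpace ℝ (Fin 3) => MvPolynomial.eval (fun i => z i) P) y = 0)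
    (hrep : ∀ t < 0, ∃ (g : ℝ → ℝ) (φ : EuclideanSpace ℝ (Fin 3) → ℝ), ∀ x,
      v t x = gradient φ x + (g ‖x - x₀‖ * MvPolynomial.eval (fun i => (x - x₀) i) P) • (x - x₀)) :
    ∀ t < 0, ∀ x, curl (v t) (x₀ + x₀ - x) = -curl (v t) x := by
  intro t ht
  obtain ⟨ĝ, -, hĝ⟩ := singleDegree_vorticity_structure v x₀ hB hm hsm hl hP hP0 hharm hrep t ht
  -- off the centre
  have hoff : ∀ x, x ≠ x₀ → curl (v t) (x₀ + x₀ - x) = -curl (v t) x := by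
    intro x hx
    have hx' : x₀ + x₀ - x ≠ x₀ := by
      intro h
      apply hx
      have h2 : x₀ + x₀ = x₀ + x := sub_eq_iff_eq_add.1 h
      exact (add_left_cancel h2).symm
    rw [hĝ x hx, hĝ _ hx']
    have e1 : x₀ + x₀ - x - x₀ = -(x - x₀) := by abel
    rw [e1, norm_neg, crossGradient_neg_of_odd hP hodd, smul_neg]
  -- at the centre, by continuity
  have hsm' : IsSmoothSpaceTimeOn (Iio 0) v := hsm
  have hv2 : ContDiff ℝ 2 (v t) := (hsm'.contDiff_slice ht).of_le (by norm_cast)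
  have hcont : Continuous (curl (v t)) := (contDiff_curl (n := 1) (by exact_mod_cast hv2)).continuous
  have hF : Continuous fun x => curl (v t) (x₀ + x₀ - x) + curl (v t) x :=
    (hcont.comp (continuous_const.sub continuous_id)).add hcont
  have hFeq : (fun x => curl (v t) (x₀ + x₀ - x) + curl (v t) x) = fun _ => (0 : EuclideanSpace ℝ (Fin 3)) :=
    Continuous.ext_on (dense_compl_singleton x₀) hF continuous_const fun x hx => by
      show curl (v t) (x₀ + x₀ - x) + curl (v t) x = 0
      rw [hoff x hx, neg_add_cancel]
  intro x
  have hx := congr_fun hFeq x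
  exact eq_neg_of_add_eq_zero_left hx

/-! ### 3. Dynamics: for an even velocity with odd vorticity the vorticity is caloric -/

/-- **PARITY SPLITTING OF THE VORTICITY EQUATION.**  Let `v` solve the vorticity formulation classically on `(−∞,0)`
(`IsVorticitySolutionOn (Iio 0) 1 v`), and let every slice be EVEN and every vorticity slice ODD under the reflection `w ↦ c − w`.  Then
`∂ₜω = Δω` pointwise on `(−∞,0) × ℝ³`: the transport `(v·∇)ω` and stretching `(ω·∇)v` terms are even, `∂ₜω` and `Δω` are odd, and the
equation at `x` minus the equation at `c − x` isolates the odd part. [folklore] -/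
theorem timeDerivWithin_vorticity_eq_laplacian_of_even
    {v : ℝ → EuclideanSpace ℝ (Fin 3) → EuclideanSpace ℝ (Fin 3)} (hV : IsVorticitySolutionOn (Iio 0) 1 v)
    (c : EuclideanSpace ℝ (Fin 3)) (heven : ∀ s < 0, ∀ y, v s (c - y) = v s y)
    (hodd : ∀ s < 0, ∀ y, curl (v s) (c - y) = -curl (v s) y) {t : ℝ} (ht : t < 0) (x : EuclideanSpace ℝ (Fin 3)) :
    timeDerivWithin (Iio 0) (vorticity v) t x = (Δ (vorticity v t)) x := by
  have E1 := hV.vorticity_eq t ht x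
  have E2 := hV.vorticity_eq t ht (c - x)
  -- (a) the time derivative is odd
  have ha : timeDerivWithin (Iio 0) (vorticity v) t (c - x) = -timeDerivWithin (Iio 0) (vorticity v) t x := by
    rw [timeDerivWithin_apply, timeDerivWithin_apply]
    have hcongr : derivWithin (fun s => vorticity v s (c - x)) (Iio 0) t =
        derivWithin (-fun s => vorticity v s x) (Iio 0) t :=
      derivWithin_congr (fun s hs => by simp only [vorticity_apply, Pi.neg_apply]; exact hodd s hs x)
        (by simp only [vorticity_apply, Pi.neg_apply]; exact hodd t ht x)
    rw [hcongr, derivWithin.neg]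
  -- (b) the spatial derivatives: `Dω(c − x) = Dω(x)`, `Dv(c − x) = −Dv(x)`
  have hωfun : (fun w => vorticity v t (c - w)) = -vorticity v t := by
    funext w; simp only [vorticity_apply, Pi.neg_apply]; exact hodd t ht w
  have hvfun : (fun w => v t (c - w)) = v t := funext fun w => heven t ht w
  have hb1 : fderiv ℝ (vorticity v t) (c - x) = fderiv ℝ (vorticity v t) x := by
    have h := fderiv_comp_const_sub (vorticity v t) c x
    rw [hωfun, fderiv_neg] at h
    exact (neg_injective h).symm
  have hb2 : fderiv ℝ (v t) (c - x) = -fderiv ℝ (v t) x := by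
    have h := fderiv_comp_const_sub (v t) c x
    rw [hvfun] at h
    rw [h, neg_neg]
  have hconv1 : convect (v t) (vorticity v t) (c - x) = convect (v t) (vorticity v t) x := by
    simp only [convect, hb1, heven t ht x]
  have hconv2 : convect (vorticity v t) (v t) (c - x) = convect (vorticity v t) (v t) x := by
    have hω : vorticity v t (c - x) = -vorticity v t x := by rw [vorticity_apply]; exact hodd t ht x
    simp only [convect, hb2, hω, _root_.neg_apply, map_neg, neg_neg]
  -- (c) the Laplacian is odd
  have hc : (Δ (vorticity v t)) (c - x) = -(Δ (vorticity v t)) x := by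
    have h := laplacian_comp_const_sub (vorticity v t) c x
    rw [hωfun, InnerProductSpace.laplacian_neg] at h
    rw [← h, Pi.neg_apply]
  -- compare the two equations
  rw [ha, hconv1, hconv2, hc, one_smul] at E2
  rw [one_smul] at E1
  -- E1 : T + A = B + L ;  E2 : -T + A = B + -L
  have h2 : (2 : ℝ) • timeDerivWithin (Iio 0) (vorticity v) t x = (2 : ℝ) • (Δ (vorticity v t)) x := by
    rw [two_smul, two_smul]
    have this : timeDerivWithin (Iio 0) (vorticity v) t x + convect (v t) (vorticity v t) x -
        (-timeDerivWithin (Iio 0) (vorticity v) t x + convect (v t) (vorticity v t) x) =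
        convect (vorticity v t) (v t) x + (Δ (vorticity v t)) x -
        (convect (vorticity v t) (v t) x + -(Δ (vorticity v t)) x) := by rw [E1, E2]
    have e1 : timeDerivWithin (Iio 0) (vorticity v) t x + convect (v t) (vorticity v t) x -
        (-timeDerivWithin (Iio 0) (vorticity v) t x + convect (v t) (vorticity v t) x) =
        timeDerivWithin (Iio 0) (vorticity v) t x + timeDerivWithin (Iio 0) (vorticity v) t x := by abel
    have e2 : convect (vorticity v t) (v t) x + (Δ (vorticity v t)) x -
        (convect (vorticity v t) (v t) x + -(Δ (vorticity v t)) x) = (Δ (vorticity v t)) x + (Δ (vorticity v t)) x := by abel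
    rw [e1, e2] at this
    exact this
  exact smul_right_injective _ (two_ne_zero (α := ℝ)) h2

/-! ### 4. Liouville: a bounded odd caloric vorticity vanishes -/

/-- **A BOUNDED ODD CALORIC VORTICITY IS ZERO.**  If the vorticity of a classical solution of the vorticity formulation on `(−∞,0)` is
bounded, solves `∂ₜω = Δω` pointwise, and every slice is odd under `w ↦ c − w`, then `ω ≡ 0`: by the Liouville theorem for bounded
ancient solutions of the heat equation (tree `Literature.Analysis.PDE.heat_liouville`, in the Carleman frame via `Carleman.dt_uncurry` /
`Carleman.lap_uncurry`) `ω` is constant on the slab, and an odd constant vanishes. [folklore] -/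
theorem curl_eq_zero_of_odd_caloric
    {v : ℝ → EuclideanSpace ℝ (Fin 3) → EuclideanSpace ℝ (Fin 3)} (hV : IsVorticitySolutionOn (Iio 0) 1 v)
    {K : ℝ} (hK : ∀ t < 0, ∀ x, ‖curl (v t) x‖ ≤ K) (c : EuclideanSpace ℝ (Fin 3))
    (hodd : ∀ s < 0, ∀ y, curl (v s) (c - y) = -curl (v s) y)
    (hheat : ∀ t < 0, ∀ x, timeDerivWithin (Iio 0) (vorticity v) t x = (Δ (vorticity v t)) x) :
    ∀ t < 0, ∀ x, curl (v t) x = 0 := by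
  have hsm : IsSmoothSpaceTimeOn (Iio 0) v := hV.smooth_velocity
  have hsmω : IsSmoothSpaceTimeOn (Iio 0) (vorticity v) := hsm.isSmoothSpaceTimeOn_vorticity isOpen_Iio.uniqueDiffOn
  have hO : IsOpen (Iio (0 : ℝ) ×ˢ (univ : Set (EuclideanSpace ℝ (Fin 3)))) := isOpen_Iio.prod isOpen_univ
  have hω2 : ContDiffOn ℝ 2 (uncurry (vorticity v)) (Iio (0 : ℝ) ×ˢ univ) := hsmω.of_le (by norm_cast)
  -- the heat equation in the Carleman frame, on the whole open slab
  have hheat' : ∀ z ∈ Iio (0 : ℝ) ×ˢ (univ : Set (EuclideanSpace ℝ (Fin 3))),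
      Carleman.dt (uncurry (vorticity v)) z = Carleman.lap (uncurry (vorticity v)) z := by
    rintro ⟨t, x⟩ hz
    have ht : t < 0 := (mem_prod.1 hz).1
    have hd : DifferentiableAt ℝ (uncurry (vorticity v)) (t, x) :=
      (hω2.differentiableOn (by norm_num)).differentiableAt (hO.mem_nhds hz)
    rw [Carleman.dt_uncurry hd, Carleman.lap_uncurry hO hz hω2, Literature.Analysis.FluidPDE.timeDeriv_apply,
      ← derivWithin_of_isOpen isOpen_Iio ht, ← timeDerivWithin_apply]
    exact hheat t ht x
  -- constancy on the slab
  have key : ∀ t t' : ℝ, t < 0 → t' < 0 → ∀ x x' : EuclideanSpace ℝ (Fin 3), curl (v t) x = curl (v t') x' := by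
    intro t t' ht ht' x x'
    have h := Literature.Analysis.PDE.heat_liouville (u := uncurry (vorticity v)) (T := 0) (A := K) (γ := 0) le_rfl
      zero_lt_one hω2 hheat' ?_ (z := (t, x)) (w := (t', x')) (mem_prod.2 ⟨ht, mem_univ _⟩)
      (mem_prod.2 ⟨ht', mem_univ _⟩)
    · simpa [vorticity_apply] using h
    · rintro ⟨τ, y⟩ hz
      have hτ : τ < 0 := (mem_prod.1 hz).1
      rw [Real.rpow_zero, mul_one]
      show ‖vorticity v τ y‖ ≤ K
      rw [vorticity_apply]
      exact hK τ hτ y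
  -- an odd constant vanishes
  intro t ht x
  have h1 : curl (v t) (c - x) = curl (v t) x := key t t ht ht (c - x) x
  rw [hodd t ht x] at h1
  have h2 : (2 : ℝ) • curl (v t) x = 0 := by
    rw [two_smul]; nth_rewrite 1 [← h1]; exact neg_add_cancel _
  exact (smul_eq_zero.1 h2).resolve_left two_ne_zero

/-! ### 5. The rung for odd degree -/

/-- ★★★ **THE RUNG `stub_singleDegreeRung` FOR ODD DEGREE `l`** (antidynamo v2 skeleton of crux `PoloidalLiouville`, stmt-1222; BC5).
A bounded ancient mild solution of Navier–Stokes (`ν = 1`, duality class) with measurable slices, jointly smooth on `(−∞,0) × ℝ³`, whose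
slices have the single-degree form `v t x = ∇φ + (g ‖x − x₀‖ · P(x − x₀)) • (x − x₀)` (`g`, `φ` ARBITRARY at each `t`) for a solid
harmonic `P` of ODD degree `l ≥ 2` (`l = 3, 5, …`), is slice-wise constant.  This is the registered signature `StubSingleDegreeRung`
with the one extra conjunct `Odd l`.  Proof: `P = 0` is the gradient branch (`constant_of_forall_gradient_slices`); otherwise the
vorticity is odd about `x₀` (`curl_reflect_of_odd`), the velocity is even (`reflect_eq_of_curl_odd`), the vorticity is caloric
(`timeDerivWithin_vorticity_eq_laplacian_of_even`, bridge `vorticityOfClass`), hence zero (`curl_eq_zero_of_odd_caloric`), and the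
slices are constant (`constantOfIrrotational`).  Even `l` is NOT covered (see the module docstring); nothing here proves the rung for
all `l`, the wall, `PoloidalLiouville`, or bears on Navier–Stokes regularity. [folklore] -/
theorem singleDegreeRung_odd
    (v : ℝ → EuclideanSpace ℝ (Fin 3) → EuclideanSpace ℝ (Fin 3)) (x₀ : EuclideanSpace ℝ (Fin 3))
    (hB : Literature.Analysis.FluidPDE.IsBoundedAncientMildSolution 1 v)
    (hm : ∀ t < 0, AEStronglyMeasurable (v t) volume)
    (hsm : ContDiffOn ℝ (⊤ : ℕ∞) (Function.uncurry v) (Set.Iio 0 ×ˢ Set.univ))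
    (hform : ∃ (l : ℕ) (P : MvPolynomial (Fin 3) ℝ), 2 ≤ l ∧ Odd l ∧ P.IsHomogeneous l ∧
      (∀ y : EuclideanSpace ℝ (Fin 3),
        Laplacian.laplacian (fun z : EuclideanSpace ℝ (Fin 3) => MvPolynomial.eval (fun i => z i) P) y = 0) ∧
      ∀ t < 0, ∃ (g : ℝ → ℝ) (φ : EuclideanSpace ℝ (Fin 3) → ℝ), ∀ x,
        v t x = gradient φ x + (g ‖x - x₀‖ * MvPolynomial.eval (fun i => (x - x₀) i) P) • (x - x₀)) :
    ∀ t < 0, ∃ b : EuclideanSpace ℝ (Fin 3), ∀ x, v t x = b := by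
  obtain ⟨l, P, hl2, hodd, hP, hharm, hrep⟩ := hform
  by_cases hP0 : P = 0
  · -- the gradient branch
    refine constant_of_forall_gradient_slices v hB hsm fun t ht => ?_
    obtain ⟨g, φ, hv⟩ := hrep t ht
    exact ⟨φ, fun x => by rw [hv x, hP0, map_zero, mul_zero, zero_smul, add_zero]⟩
  -- a genuine single-degree toroidal mode of odd degree
  have hcurlodd : ∀ t < 0, ∀ x, curl (v t) (x₀ + x₀ - x) = -curl (v t) x :=
    curl_reflect_of_odd v x₀ hB hm hsm hl2 hodd hP hP0 hharm hrep
  have hsm' : IsSmoothSpaceTimeOn (Iio 0) v := hsm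
  obtain ⟨M, hM⟩ := hB.isBoundedOn
  have heven : ∀ t < 0, ∀ y, v t (x₀ + x₀ - y) = v t y := by
    intro t ht
    have hvt : ContDiff ℝ ∞ (v t) := hsm'.contDiff_slice ht
    have hv2 : ContDiff ℝ 2 (v t) := hvt.of_le (by norm_cast)
    have hv1 : ContDiff ℝ 1 (v t) := hvt.of_le (by norm_cast)
    have hdiv : VectorCalculus.IsDivFree (v t) := (hB.isAncientMildSolution.1 t ht).isDivFree_of_contDiff hv1
    exact reflect_eq_of_curl_odd hv2 hdiv (fun y => hM t ht y) (x₀ + x₀) (hcurlodd t ht)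
  obtain ⟨hV, K, hK⟩ := PoloidalLiouville.vorticityOfClass v hB hm hsm
  have hheat : ∀ t < 0, ∀ x, timeDerivWithin (Iio 0) (vorticity v) t x = (Δ (vorticity v t)) x :=
    fun t ht x => timeDerivWithin_vorticity_eq_laplacian_of_even hV (x₀ + x₀) heven hcurlodd ht x
  have hcurl0 : ∀ t < 0, ∀ x, curl (v t) x = 0 := curl_eq_zero_of_odd_caloric hV hK (x₀ + x₀) hcurlodd hheat
  exact PoloidalLiouville.constantOfIrrotational v hB hsm hcurl0

end Summit.NavierStokesRegularity.NavierStokesRegularity.Theorems.PoloidalLiouville.Antidynamo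

end
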